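/-
Copyright (c) 2026 the pub-hodgecm-mathlib formalisation cell (harness21).  Prover seat hodgecm-mathlib-K2E3-p24 (g0), Track B «K2-LIT» ∕ h413
(`stmt-HodgeConjecture-24833`), line `K2_E3_EllipticInputs`, road (11-3-split-nsc), leaf (nsc-S-C′) `sig_K2E3GL3TwoBlockCuspidalSupportCharLocInt`,
brick (hInd-ASM): THE CHARACTER OF `Ind_{P_c}^{GL_N}(σ)` IS AN INTEGRABLE FUNCTION NEAR EVERY POINT, GIVEN AN `L¹_loc` CHARACTER OF `σ` ON `M_c` AND (AC).  2026-09-04.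
-/
import Summits.HodgeConjecture.HodgeConjecture.Theorems.K2E3ParabolicCharacterLeviUnipotentGL    -- ★ (vD-σ-MU-GL) p858766 + ★ (vD-σ-GL) p858696 (K2E3-p24 g0)
import Summits.HodgeConjecture.HodgeConjecture.Theorems.K2E3PushforwardDensityOfIntegrable        -- ★ (RN′) p858602 (K2E3-p24 g0)
import Summits.HodgeConjecture.HodgeConjecture.Theorems.K2E3KMUWeightIntegrable                   -- ★ (hInd-W) p858776 (K2E3-p24 g0)
import Literature.NumberTheory.Automorphic.VanDijkTraceParabolicIndGLProof                         -- ★ `isCompact_glInt_mul_mul_glInt`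
import Literature.NumberTheory.Automorphic.TateLocalFactors                                         -- ★ `SchwartzBruhat`
import HarnessLib

/-!
# K2_E3 road (h413), leaf (nsc-S-C′), brick (hInd-ASM) — the character of `Ind_{P_c}^{GL_N}(σ)` (`σ` ADMISSIBLE, any dimension) is an integrable function near
# every `g`, GIVEN an `L¹_loc` character of `σ_M = (σ∘proj|_{M_c}) ⊗ δ^{1∕2}|_{M_c}` on `M_c` and the absolute continuity (AC) of the `K M U` push-forward

Cell `pub/hodgecm-mathlib` (D-0151), Track B, seat K2E3-p24 (g0) = hand of the hosted leaf (nsc-S-C′) (road owner K2E3-p11 (g6); TIE-CAND v1.1).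
`--supports stmt-HodgeConjecture-24833 --as helper`; THEOREMS ONLY (no definition ∕ instance ∕ notation ∕ named fact ∕ `sorry`); never imports `Cruxes/…/Lines`.
COUNT-NEUTRAL: this is the (hInd) binder of ★ F3 `charLocIntNear_twoBlockCuspidalSupport_of_irreducible_of_ind` REDUCED to the one printed letter (HC-σ-Levi)
«a supercuspidal `σ` has an `L¹_loc` character» [HarishChandra1970]; (AC) is ★ for both two-block labels of `GL₃` (K2E3-p11 (g6) p858599∕p858679).

THE MATHEMATICS ([vanDijk1972, Thm. p. 237]; [HarishChandra1999, §16 Thm. 16.1 p. 77]; [Folland1999, Thm. 3.8]) — the general-`σ` twin of ★ (nsc-vD-gen)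
`K2E3CharLocIntNearParabolicIndOfAC` (K2E3-p11 (g6)), whose localisation skeleton is reused verbatim.  `tr Ind(σ)(f dμ₀) = ∫_K C·tr σ_P(F_k) dμ_K` (★ (vD-σ-GL)),
`tr σ_P(F_k) = tr σ_M(F̄_k)` (★ (vD-σ-MU-GL), `F̄_k(m) = ∫_U f(k⁻¹muk) dμ_U`), `tr σ_M(φ) = ∫_M φ Θ dν_M` (HYPOTHESIS (HC-σ-Levi), `Θ ∈ L¹_loc(M_c)`), so the character
is the push-forward under `Ψ(k,m,u) = k⁻¹muk` of `C·Θ(m)·(μ_K ⊗ ν_M ⊗ μ_U)`; for `f` supported in `U = gK` the parameters live in a compact box `K × S_M × S_U` on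
which the weight is INTEGRABLE (★ (hInd-W)), (AC) gives `(Ψ_*μ_X)|_U ≪ μ₀`, and ★ RN′ produces `Θ_G ∈ L¹(U)`.
* **`charLocIntNear_parabolicIndGL_of_leviCharacter`** — every `N`, monotone `c`, admissible `σ`, Haar `μ₀`, under (HC-σ-Levi) and (AC): (GL-11) at every `g`.

HONEST LABEL: HC_CM is proved only modulo the 7 printed citations (2 remaining named inputs: hLiu418 = stmt-HodgeConjecture-24832, h413 =
stmt-HodgeConjecture-24833) until rung 0 closes; count-neutral helper; (HC-σ-Levi) is a HYPOTHESIS here (K2E5-p17 (g5)'s GL₂ road + ⊠∕transport plumbing).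

## References
* [vanDijk1972] G. van Dijk, *Computation of certain induced characters of 𝔭-adic groups*, Math. Ann. 199 (1972), 229–240, Thm. p. 237.
* [HarishChandra1999] Harish-Chandra (DeBacker–Sally), *Admissible Invariant Distributions on Reductive p-adic Groups* (1999), §16 Thm. 16.1 p. 77.
* [HarishChandra1970] Harish-Chandra (notes by G. van Dijk), *Harmonic analysis on reductive 𝔭-adic groups*, LNM 162 (1970).
* [Folland1999] G. B. Folland, *Real Analysis*, 2nd ed. (1999), §2.5 Thm. 2.37, §3.2 Thm. 3.8.
-/

set_option autoImplicit false
set_option linter.dupNamespace false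

noncomputable section

open MeasureTheory MeasureTheory.Measure Topology TopologicalSpace Set
open scoped MatrixGroups NNReal ENNReal

namespace Summit.HodgeConjecture.HodgeConjecture.Cruxes.H413.K2E3CharLocIntNearParabolicIndOfLeviCharacter

open Literature.NumberTheory.Automorphic Representation
open Literature.NumberTheory.GaloisRepresentations.IsNonarchimedeanLocalField
open Summit.HodgeConjecture.HodgeConjecture.Cruxes.H413.K2E3ParabolicCharacterLeviUnipotentGL
open Summit.HodgeConjecture.HodgeConjecture.Cruxes.H413.K2E3ParabolicIndCharacterGeneral
open Summit.HodgeConjecture.HodgeConjecture.Cruxes.H413.K2E3PushforwardDensityOfIntegrable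
open Summit.HodgeConjecture.HodgeConjecture.Cruxes.H413.K2E3KMUWeightIntegrable

variable {F : Type} [Field F] [ValuativeRel F] [TopologicalSpace F] [IsNonarchimedeanLocalField F]
  {N : ℕ} {α : Type*} [LinearOrder α] [Fintype α] {c : Fin N → α}
  [MeasurableSpace (GL (Fin N) F)] [BorelSpace (GL (Fin N) F)]
  {W : Type*} [AddCommGroup W] [Module ℂ W]

set_option maxHeartbeats 3200000 in
/-- **(hInd-ASM) THE CHARACTER OF `Ind_{P_c}^{GL_N}(σ)` IS AN INTEGRABLE FUNCTION NEAR EVERY POINT, GIVEN (HC-σ-Levi) AND (AC).**  `c` monotone, `σ` an admissible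
representation of the block Levi (any dimension), `μ₀` a Haar measure on `GL_N(F)`.  Assume (HC-σ-Levi): for every Haar measure `ν_M` on `M_c` the character of
`σ_M = (σ ∘ proj|_{M_c}) ⊗ δ_{P_c}^{1∕2}|_{M_c}` is a LOCALLY INTEGRABLE function `Θ` (`tr σ_M(φ dν_M) = ∫ φ Θ dν_M` for locally constant compactly supported `φ`);
and (AC): the conjugated `K × M_c × U_c` push-forward charges no `μ₀`-null set.  Then for every `g` there are an open `U ∋ g` and `Θ_G` integrable on `U` with
`tr (parabolicIndGL F c σ)(f dμ₀) = ∫ f Θ_G dμ₀` for all Schwartz–Bruhat `f` with `tsupport f ⊆ U`. [cite: vanDijk1972, Thm. p. 237]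
[cite: HarishChandra1999, §16 Thm. 16.1 p. 77] [cite: Folland1999, §3.2 Thm. 3.8] -/
theorem charLocIntNear_parabolicIndGL_of_leviCharacter (hc : Monotone c)
    (σ : Representation ℂ (Π a, GL {i : Fin N // c i = a} F) W) (hσ : σ.IsAdmissible)
    (μ₀ : Measure (GL (Fin N) F)) [μ₀.IsHaarMeasure]
    (hΘ : ∀ (νM : Measure ↥(standardLeviGL F c)) [νM.IsHaarMeasure], ∃ Θ : ↥(standardLeviGL F c) → ℂ, LocallyIntegrable Θ νM ∧
      ∀ φ : ↥(standardLeviGL F c) → ℂ, IsLocallyConstant φ → HasCompactSupport φ →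
        (Representation.twist (σ.comp ((leviProjection F c).comp (Subgroup.inclusion (standardLeviGL_le F c))))
            ((rootDeltaChar (standardParabolicGL F c)).comp (Subgroup.inclusion (standardLeviGL_le F c)))).smoothTrace νM φ =
          ∫ m, φ m * Θ m ∂νM)
    (hAC : ∀ (νM : Measure ↥(standardLeviGL F c)) [νM.IsHaarMeasure] (μU : Measure ↥(unipotentRadicalGL F c)) [μU.IsHaarMeasure]
      (μK : Measure ↥(glInt N F)) [μK.IsHaarMeasure] (A : Set (GL (Fin N) F)), MeasurableSet A → μ₀ A = 0 →
      (μK.prod (νM.prod μU)) {t : ↥(glInt N F) × (↥(standardLeviGL F c) × ↥(unipotentRadicalGL F c)) |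
        ((t.1 : GL (Fin N) F))⁻¹ * ((t.2.1 : GL (Fin N) F) * (t.2.2 : GL (Fin N) F)) * (t.1 : GL (Fin N) F) ∈ A} = 0)
    (g : GL (Fin N) F) :
    ∃ U : Set (GL (Fin N) F), IsOpen U ∧ g ∈ U ∧ ∃ Θ : GL (Fin N) F → ℂ, IntegrableOn Θ U μ₀ ∧
      ∀ f : GL (Fin N) F → ℂ, f ∈ SchwartzBruhat (GL (Fin N) F) → tsupport f ⊆ U →
        (Representation.parabolicIndGL F c σ).smoothTrace μ₀ f = ∫ x, f x * Θ x ∂μ₀ := by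
  classical
  ------------------------------------------------------------------
  -- frame (as in ★ (nsc-vD-gen))
  ------------------------------------------------------------------
  haveI : IsTopologicalRing F := inferInstance
  haveI : T2Space F := (isLocalField F).toT2Space
  haveI : LocallyCompactSpace F := (isLocalField F).toLocallyCompactSpace
  haveI : SecondCountableTopology F := secondCountableTopology_localField F
  haveI : SecondCountableTopology (Matrix (Fin N) (Fin N) F) := inferInstanceAs (SecondCountableTopology (Fin N → Fin N → F))
  haveI : SecondCountableTopology (Matrix (Fin N) (Fin N) F)ᵐᵒᵖ := MulOpposite.opHomeomorph.symm.secondCountableTopology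
  haveI : SecondCountableTopology (GL (Fin N) F) := Units.isEmbedding_embedProduct.secondCountableTopology
  haveI : LocallyCompactSpace (Matrix (Fin N) (Fin N) F) := inferInstanceAs (LocallyCompactSpace (Fin N → Fin N → F))
  haveI : LocallyCompactSpace (GL (Fin N) F) := inferInstance
  haveI : NonarchimedeanGroup (GL (Fin N) F) := nonarchimedeanGroup_gl F N
  have hKo : IsOpen (glInt N F : Set (GL (Fin N) F)) := isOpen_glInt (n := N) (F := F)
  have hKc : IsCompact (glInt N F : Set (GL (Fin N) F)) := isCompact_glInt (n := N) (F := F)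
  haveI : CompactSpace ↥(glInt N F) := isCompact_iff_compactSpace.1 hKc
  have hPcl : IsClosed (standardParabolicGL F c : Set (GL (Fin N) F)) := isClosed_standardParabolicGL F c
  have hMcl : IsClosed (standardLeviGL F c : Set (GL (Fin N) F)) := isClosed_standardLeviGL (R := F) c
  have hUcl : IsClosed (unipotentRadicalGL F c : Set (GL (Fin N) F)) := isClosed_unipotentRadicalGL (R := F) c
  haveI : SecondCountableTopology ↥(standardLeviGL F c) := inferInstanceAs (SecondCountableTopology ↥((standardLeviGL F c : Set (GL (Fin N) F))))
  haveI : SecondCountableTopology ↥(unipotentRadicalGL F c) :=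
    inferInstanceAs (SecondCountableTopology ↥((unipotentRadicalGL F c : Set (GL (Fin N) F))))
  haveI : SecondCountableTopology ↥(glInt N F) := inferInstanceAs (SecondCountableTopology ↥((glInt N F : Set (GL (Fin N) F))))
  haveI : LocallyCompactSpace ↥(standardLeviGL F c) := hMcl.locallyCompactSpace
  haveI : LocallyCompactSpace ↥(unipotentRadicalGL F c) := hUcl.locallyCompactSpace
  haveI : LocallyCompactSpace ↥(standardParabolicGL F c) := hPcl.locallyCompactSpace
  haveI : SigmaCompactSpace (GL (Fin N) F) := sigmaCompactSpace_of_locallyCompact_secondCountable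
  haveI : SigmaCompactSpace ↥(standardLeviGL F c) := hMcl.isClosedEmbedding_subtypeVal.sigmaCompactSpace
  haveI : SigmaCompactSpace ↥(unipotentRadicalGL F c) := hUcl.isClosedEmbedding_subtypeVal.sigmaCompactSpace
  haveI : BorelSpace (↥(standardLeviGL F c) × ↥(unipotentRadicalGL F c)) := Prod.borelSpace
  haveI : BorelSpace (↥(glInt N F) × (↥(standardLeviGL F c) × ↥(unipotentRadicalGL F c))) := Prod.borelSpace
  -- Haar measures on `M_c`, `U_c`, `K`, and `P_c = M_c ⋉ U_c`
  set νM : Measure ↥(standardLeviGL F c) := Measure.haar with hνM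
  set μU : Measure ↥(unipotentRadicalGL F c) := Measure.haar with hμU
  set μK : Measure ↥(glInt N F) := Measure.haar with hμK
  haveI : SigmaFinite νM := inferInstance
  haveI : SigmaFinite μU := inferInstance
  haveI : SigmaFinite μK := inferInstance
  haveI : IsFiniteMeasure μK := CompactSpace.isFiniteMeasure
  obtain ⟨μP, hμP, hPint⟩ := GLn.exists_haar_parabolic_integral_eq_levi_unipotent (F := F) (c := c) νM μU
  haveI := hμP
  -- ★ (vD-σ-GL): `tr π(f) = ∫_K C · tr σ_P(F_k)`
  obtain ⟨C, hC, -, hKP⟩ := GLn.exists_smoothTrace_parabolicIndGL_eq_integral_KP (F := F) hc σ hσ μ₀ μP μK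
  -- (HC-σ-Levi): the `L¹_loc` character of `σ_M`, made measurable
  obtain ⟨Θ₀, hΘ₀li, hΘ₀⟩ := hΘ νM
  have hΘ₀m : AEStronglyMeasurable Θ₀ νM := hΘ₀li.aestronglyMeasurable
  set Θ : ↥(standardLeviGL F c) → ℂ := hΘ₀m.mk Θ₀ with hΘdef
  have hΘmeas : Measurable Θ := hΘ₀m.stronglyMeasurable_mk.measurable
  have hΘae : Θ₀ =ᵐ[νM] Θ := hΘ₀m.ae_eq_mk
  have hΘtr : ∀ φ : ↥(standardLeviGL F c) → ℂ, IsLocallyConstant φ → HasCompactSupport φ →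
      (Representation.twist (σ.comp ((leviProjection F c).comp (Subgroup.inclusion (standardLeviGL_le F c))))
          ((rootDeltaChar (standardParabolicGL F c)).comp (Subgroup.inclusion (standardLeviGL_le F c)))).smoothTrace νM φ =
        ∫ m, φ m * Θ m ∂νM := fun φ hφ hφc => by
    rw [hΘ₀ φ hφ hφc]
    exact integral_congr_ae (hΘae.mono fun m hm => by simp only [hm])
  ------------------------------------------------------------------
  -- the neighbourhood `U = g·K` and the compact parameter box (as in ★ (nsc-vD-gen))
  ------------------------------------------------------------------
  set U : Set (GL (Fin N) F) := (fun x : GL (Fin N) F => g * x) '' (glInt N F : Set (GL (Fin N) F)) with hUdef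
  have hUo : IsOpen U := (isOpenMap_mul_left g) _ hKo
  have hUc : IsCompact U := hKc.image (continuous_const.mul continuous_id)
  have hgU : g ∈ U := ⟨1, (glInt N F).one_mem, mul_one g⟩
  have hUm : MeasurableSet U := hUo.measurableSet
  set T : Set (GL (Fin N) F) := (fun t : GL (Fin N) F × GL (Fin N) F × GL (Fin N) F => t.1 * t.2.1 * t.2.2) ''
      ((glInt N F : Set (GL (Fin N) F)) ×ˢ U ×ˢ (glInt N F : Set (GL (Fin N) F))) with hTdef
  have hT : IsCompact T := isCompact_glInt_mul_mul_glInt (F := F) (N := N) hUc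
  have hmemT : ∀ (k : ↥(glInt N F)) (q : ↥(standardLeviGL F c) × ↥(unipotentRadicalGL F c)),
      (k : GL (Fin N) F)⁻¹ * ((q.1 : GL (Fin N) F) * (q.2 : GL (Fin N) F)) * (k : GL (Fin N) F) ∈ U →
        (q.1 : GL (Fin N) F) * (q.2 : GL (Fin N) F) ∈ T := by
    intro k q hq
    refine ⟨((k : GL (Fin N) F), (k : GL (Fin N) F)⁻¹ * ((q.1 : GL (Fin N) F) * (q.2 : GL (Fin N) F)) * (k : GL (Fin N) F), (k : GL (Fin N) F)⁻¹),
      Set.mk_mem_prod k.2 (Set.mk_mem_prod hq ((glInt N F).inv_mem k.2)), ?_⟩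
    simp only
    group
  obtain ⟨e, he⟩ := exists_homeomorph_levi_prod_unipotent_coe_eq (R := F) (c := c)
  set S : Set (↥(standardLeviGL F c) × ↥(unipotentRadicalGL F c)) :=
    e.symm '' (((↑) : ↥(standardParabolicGL F c) → GL (Fin N) F) ⁻¹' T) with hSdef
  have hS : IsCompact S := (hPcl.isClosedEmbedding_subtypeVal.isCompact_preimage hT).image e.symm.continuous
  have hmemS : ∀ q : ↥(standardLeviGL F c) × ↥(unipotentRadicalGL F c), (q.1 : GL (Fin N) F) * (q.2 : GL (Fin N) F) ∈ T → q ∈ S := by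
    intro q hq
    refine ⟨e q, ?_, e.symm_apply_apply q⟩
    rw [Set.mem_preimage, he]
    exact hq
  set SM : Set ↥(standardLeviGL F c) := Prod.fst '' S with hSMdef
  set SU : Set ↥(unipotentRadicalGL F c) := Prod.snd '' S with hSUdef
  have hSM : IsCompact SM := hS.image continuous_fst
  have hSU : IsCompact SU := hS.image continuous_snd
  have hSMm : MeasurableSet SM := hSM.isClosed.measurableSet
  have hSUm : MeasurableSet SU := hSU.isClosed.measurableSet
  have hSUfin : μU SU ≠ ∞ := hSU.measure_lt_top.ne
  have hSbox : S ⊆ SM ×ˢ SU := fun q hq => Set.mk_mem_prod ⟨q, hq, rfl⟩ ⟨q, hq, rfl⟩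
  set Box : Set (↥(glInt N F) × (↥(standardLeviGL F c) × ↥(unipotentRadicalGL F c))) := (Set.univ : Set ↥(glInt N F)) ×ˢ (SM ×ˢ SU) with hBoxdef
  have hBoxm : MeasurableSet Box := MeasurableSet.univ.prod (hSMm.prod hSUm)
  -- `Θ` is integrable on the compact `S_M`
  have hΘS : IntegrableOn Θ SM νM := (hΘ₀li.integrableOn_isCompact hSM).congr (ae_restrict_of_ae hΘae)
  ------------------------------------------------------------------
  -- the finite parameter measure, the map `Ψ`, the INTEGRABLE weight `Fw = C · 1_{S_M} Θ`
  ------------------------------------------------------------------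
  set Pm : Measure (↥(glInt N F) × (↥(standardLeviGL F c) × ↥(unipotentRadicalGL F c))) := μK.prod (νM.prod μU) with hPm
  set μX : Measure (↥(glInt N F) × (↥(standardLeviGL F c) × ↥(unipotentRadicalGL F c))) := Pm.restrict Box with hμX
  set Ψ : ↥(glInt N F) × (↥(standardLeviGL F c) × ↥(unipotentRadicalGL F c)) → GL (Fin N) F := fun t =>
      ((t.1 : GL (Fin N) F))⁻¹ * ((t.2.1 : GL (Fin N) F) * (t.2.2 : GL (Fin N) F)) * (t.1 : GL (Fin N) F) with hΨdef
  have hΨc : Continuous Ψ :=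
    ((continuous_subtype_val.comp continuous_fst).inv.mul
      ((continuous_subtype_val.comp (continuous_fst.comp continuous_snd)).mul (continuous_subtype_val.comp (continuous_snd.comp continuous_snd)))).mul
      (continuous_subtype_val.comp continuous_fst)
  have hΨm : Measurable Ψ := hΨc.measurable
  set Fw : ↥(glInt N F) × (↥(standardLeviGL F c) × ↥(unipotentRadicalGL F c)) → ℂ := fun t => (C : ℂ) * SM.indicator Θ t.2.1 with hFwdef
  have hFwm : Measurable Fw := measurable_const.mul ((hΘmeas.indicator hSMm).comp (measurable_fst.comp measurable_snd))
  have hFwi : Integrable Fw μX := by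
    rw [hμX, hPm, hBoxdef]
    exact (integrable_comp_snd_fst_restrict_box μK νM μU hSUfin (Θ := SM.indicator Θ) ((hΘS.integrable_indicator hSMm).integrableOn)).const_mul _
  -- (AC) ⇒ `(Ψ_* μX)|_U ≪ μ₀`
  have hac : ((μX.map Ψ).restrict U) ≪ μ₀ := by
    refine Measure.AbsolutelyContinuous.mk fun s hs hs0 => ?_
    have h1 : Pm (Ψ ⁻¹' s) = 0 := hAC νM μU μK s hs hs0
    have h2 : μX (Ψ ⁻¹' s) = 0 := (Measure.absolutelyContinuous_of_le Measure.restrict_le_self) h1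
    rw [Measure.restrict_apply hs, Measure.map_apply hΨm (hs.inter hUm)]
    exact measure_mono_null (Set.preimage_mono Set.inter_subset_left) h2
  -- ★ RN′
  obtain ⟨ΘG, hΘGi, hΘG⟩ := exists_integrable_forall_integral_mul_comp_eq_of_integrable μX hΨm hFwm hFwi μ₀ hUm hac
  refine ⟨U, hUo, hgU, ΘG, hΘGi.integrableOn, fun f hf hfU => ?_⟩
  ------------------------------------------------------------------
  -- the test function; the trace as a triple integral against `Θ`
  ------------------------------------------------------------------
  have hflc : IsLocallyConstant f := (mem_schwartzBruhat_iff.1 hf).1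
  have hfcs : HasCompactSupport f := (mem_schwartzBruhat_iff.1 hf).2
  have hfc : Continuous f := hflc.continuous
  obtain ⟨Bf, hBf⟩ := hfc.bounded_above_of_compact_support hfcs
  have hfU' : ∀ x, x ∉ U → f x = 0 := fun x hx => image_eq_zero_of_notMem_tsupport fun h => hx (hfU h)
  obtain ⟨K', hK'⟩ := exists_isLevel (G := GL (Fin N) F) (f := f) ⟨hflc, hfcs⟩
  rw [← hΘG f Bf hfc.measurable hBf hfU', hKP f hflc hfcs]
  -- for each `k`: `tr σ_P(F_k) = tr σ_M(F̄_k) = ∫_M (∫_U f(k⁻¹ m u k)) Θ(m)` (★ (vD-σ-MU-GL) + (HC-σ-Levi))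
  have hk : ∀ k : ↥(glInt N F),
      (Representation.twist (σ.comp (leviProjection F c)) (rootDeltaChar (standardParabolicGL F c))).smoothTrace μP
          (fun p : ↥(standardParabolicGL F c) => f ((k : GL (Fin N) F)⁻¹ * (p : GL (Fin N) F) * (k : GL (Fin N) F))) =
        ∫ m : ↥(standardLeviGL F c), (∫ u : ↥(unipotentRadicalGL F c),
          f ((k : GL (Fin N) F)⁻¹ * ((m : GL (Fin N) F) * (u : GL (Fin N) F)) * (k : GL (Fin N) F)) ∂μU) * Θ m ∂νM := by
    intro k
    -- the level `k K′ k⁻¹` of `F_k`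
    set K₁ : Subgroup (GL (Fin N) F) := K'.comap (MulAut.conj ((k : GL (Fin N) F)⁻¹)).toMonoidHom with hK₁
    have hK₁set : (K₁ : Set (GL (Fin N) F)) = (fun x => (k : GL (Fin N) F)⁻¹ * x * (k : GL (Fin N) F)) ⁻¹' (K' : Set (GL (Fin N) F)) := by
      ext x
      simp [hK₁]
    have hK₁o : IsOpen (K₁ : Set (GL (Fin N) F)) := by
      rw [hK₁set]; exact hK'.isOpen.preimage ((continuous_const.mul continuous_id).mul continuous_const)
    have hK₁c : IsCompact (K₁ : Set (GL (Fin N) F)) := by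
      rw [hK₁set]
      exact (((Homeomorph.mulLeft ((k : GL (Fin N) F)⁻¹)).trans (Homeomorph.mulRight (k : GL (Fin N) F))).isCompact_preimage).2 hK'.isCompact
    have hmemK₁ : ∀ x : GL (Fin N) F, x ∈ K₁ ↔ (k : GL (Fin N) F)⁻¹ * x * (k : GL (Fin N) F) ∈ K' := fun x => by
      rw [← SetLike.mem_coe, hK₁set]; rfl
    have hFK₁ : IsLevel (K₁.comap (standardParabolicGL F c).subtype)
        (fun p : ↥(standardParabolicGL F c) => f ((k : GL (Fin N) F)⁻¹ * (p : GL (Fin N) F) * (k : GL (Fin N) F))) := by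
      refine ⟨?_, ?_, fun p₀ hp₀ p => ?_, fun p₀ hp₀ p => ?_⟩
      · rw [Subgroup.coe_comap]; exact hK₁o.preimage continuous_subtype_val
      · rw [Subgroup.coe_comap]; exact hPcl.isClosedEmbedding_subtypeVal.isCompact_preimage hK₁c
      · have h0 : (k : GL (Fin N) F)⁻¹ * (p₀ : GL (Fin N) F) * (k : GL (Fin N) F) ∈ K' := (hmemK₁ _).1 (Subgroup.mem_comap.1 hp₀)
        simp only [Subgroup.coe_mul]
        have : (k : GL (Fin N) F)⁻¹ * ((p : GL (Fin N) F) * (p₀ : GL (Fin N) F)) * (k : GL (Fin N) F) =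
            ((k : GL (Fin N) F)⁻¹ * (p : GL (Fin N) F) * (k : GL (Fin N) F)) * ((k : GL (Fin N) F)⁻¹ * (p₀ : GL (Fin N) F) * (k : GL (Fin N) F)) := by group
        rw [this, hK'.mul_right _ h0]
      · have h0 : (k : GL (Fin N) F)⁻¹ * (p₀ : GL (Fin N) F) * (k : GL (Fin N) F) ∈ K' := (hmemK₁ _).1 (Subgroup.mem_comap.1 hp₀)
        simp only [Subgroup.coe_mul]
        have : (k : GL (Fin N) F)⁻¹ * ((p₀ : GL (Fin N) F) * (p : GL (Fin N) F)) * (k : GL (Fin N) F) =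
            ((k : GL (Fin N) F)⁻¹ * (p₀ : GL (Fin N) F) * (k : GL (Fin N) F)) * ((k : GL (Fin N) F)⁻¹ * (p : GL (Fin N) F) * (k : GL (Fin N) F)) := by group
        rw [this, hK'.mul_left _ h0]
    have hFlck : IsLocallyConstant (fun p : ↥(standardParabolicGL F c) => f ((k : GL (Fin N) F)⁻¹ * (p : GL (Fin N) F) * (k : GL (Fin N) F))) :=
      hflc.comp_continuous ((continuous_const.mul continuous_subtype_val).mul continuous_const)
    have hFck : HasCompactSupport (fun p : ↥(standardParabolicGL F c) => f ((k : GL (Fin N) F)⁻¹ * (p : GL (Fin N) F) * (k : GL (Fin N) F))) :=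
      (hfcs.comp_homeomorph ((Homeomorph.mulLeft ((k : GL (Fin N) F)⁻¹)).trans (Homeomorph.mulRight (k : GL (Fin N) F)))).comp_isClosedEmbedding
        hPcl.isClosedEmbedding_subtypeVal
    obtain ⟨hbarlc, hbarc, htr⟩ :=
      GLn.smoothTrace_twist_comp_leviProjection_eq_fibreIntegral (F := F) σ hσ μP νM μU hPint hK₁o hK₁c hFlck hFck hFK₁
    rw [htr, hΘtr _ hbarlc hbarc]
  simp_rw [hk]
  ------------------------------------------------------------------
  -- Fubini: `∫_K C ∫_M (∫_U …) Θ = ∫_{Box} Fw · (f ∘ Ψ) d(μ_K ⊗ ν_M ⊗ μ_U)`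
  ------------------------------------------------------------------
  set H3 : ↥(glInt N F) × (↥(standardLeviGL F c) × ↥(unipotentRadicalGL F c)) → ℂ := fun t => f (Ψ t) * Θ t.2.1 with hH3
  have hH3m : AEStronglyMeasurable H3 Pm :=
    ((hfc.comp hΨc).aestronglyMeasurable).mul (hΘmeas.comp (measurable_fst.comp measurable_snd)).aestronglyMeasurable
  have hH3b : ∀ t, ‖H3 t‖ ≤ Bf * ‖Θ t.2.1‖ := fun t => by
    rw [hH3, norm_mul]; exact mul_le_mul_of_nonneg_right (hBf _) (norm_nonneg _)
  have hsuppS : ∀ (k : ↥(glInt N F)) (q : ↥(standardLeviGL F c) × ↥(unipotentRadicalGL F c)), f (Ψ (k, q)) ≠ 0 → q ∈ S :=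
    fun k q hne => hmemS q (hmemT k q (hfU (subset_tsupport _ hne)))
  have hzero : ∀ t : ↥(glInt N F) × (↥(standardLeviGL F c) × ↥(unipotentRadicalGL F c)), t.2 ∉ S → H3 t = 0 := by
    intro t ht
    simp only [hH3]
    by_contra hne
    exact ht (hsuppS t.1 t.2 fun h => hne (by rw [h, zero_mul]))
  have hsupp3 : Function.support H3 ⊆ Box := fun t ht =>
    Set.mk_mem_prod (Set.mem_univ _) (hSbox (by by_contra h; exact ht (hzero t h)))
  have hI2 : Integrable H3 Pm := integrable_of_norm_le_of_support_subset_box μK νM μU hSUfin hΘS hH3m hH3b hsupp3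
  have hIk : ∀ k : ↥(glInt N F), Integrable (fun q : ↥(standardLeviGL F c) × ↥(unipotentRadicalGL F c) => H3 (k, q)) (νM.prod μU) := by
    intro k
    refine integrable_of_norm_le_of_support_subset_prod νM μU hSUfin hΘS ?_ (fun q => hH3b (k, q)) fun q hq => hSbox ?_
    · exact (((hfc.comp hΨc).comp (Continuous.prodMk_right k)).aestronglyMeasurable).mul
        (hΘmeas.comp measurable_fst).aestronglyMeasurable
    · by_contra h; exact hq (hzero (k, q) h)
  -- Step A: inner double integral = product integral
  have hA : ∀ k : ↥(glInt N F), ∫ m : ↥(standardLeviGL F c), (∫ u : ↥(unipotentRadicalGL F c),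
      f ((k : GL (Fin N) F)⁻¹ * ((m : GL (Fin N) F) * (u : GL (Fin N) F)) * (k : GL (Fin N) F)) ∂μU) * Θ m ∂νM =
      ∫ q : ↥(standardLeviGL F c) × ↥(unipotentRadicalGL F c), H3 (k, q) ∂(νM.prod μU) := by
    intro k
    rw [integral_prod _ (hIk k)]
    refine integral_congr_ae (Filter.Eventually.of_forall fun m => ?_)
    simp only [hH3]
    rw [← integral_mul_const]
  simp_rw [hA]
  -- Step B: `∫_K C · ∫_{M×U} = ∫_{K×(M×U)} C · H3`
  have hI2C : Integrable (fun t : ↥(glInt N F) × (↥(standardLeviGL F c) × ↥(unipotentRadicalGL F c)) => (C : ℂ) * H3 t) Pm := hI2.const_mul _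
  have hB' : ∫ k : ↥(glInt N F), (C : ℂ) * ∫ q : ↥(standardLeviGL F c) × ↥(unipotentRadicalGL F c), H3 (k, q) ∂(νM.prod μU) ∂μK =
      ∫ t, (C : ℂ) * H3 t ∂Pm := by
    rw [hPm, integral_prod _ hI2C]
    refine integral_congr_ae (Filter.Eventually.of_forall fun k => ?_)
    simp only
    rw [integral_const_mul]
  rw [hB']
  -- Step C: restrict to the box, where `C · H3 = Fw · (f ∘ Ψ)`
  have hptw : ∀ t, Box.indicator (fun t => Fw t * f (Ψ t)) t = (C : ℂ) * H3 t := by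
    intro t
    by_cases ht : t ∈ Box
    · have hm : t.2.1 ∈ SM := (Set.mem_prod.1 (Set.mem_prod.1 ht).2).1
      rw [Set.indicator_of_mem ht, hFwdef, hH3]
      simp only
      rw [Set.indicator_of_mem hm]
      ring
    · have ht2 : t.2 ∉ S := fun h => ht (Set.mk_mem_prod (Set.mem_univ _) (hSbox h))
      rw [Set.indicator_of_notMem ht, hzero t ht2, mul_zero]
  rw [hμX, ← integral_indicator hBoxm]
  exact integral_congr_ae (Filter.Eventually.of_forall fun t => (hptw t).symm)

end Summit.HodgeConjecture.HodgeConjecture.Cruxes.H413.K2E3CharLocIntNearParabolicIndOfLeviCharacter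

end
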